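import Summits.QuantumFields.BalabanUV.T4Continuum.Support.AveragingDeficitCovGrad
import Summits.QuantumFields.BalabanUV.T4Continuum.Support.NE3LatticeWeitzenbock

/-!
# T⁴ programme, node NE3 — COVARIANT LATTICE CALCULUS AT A UNITARY BACKGROUND (HS currency): the real Hilbert–Schmidt form,
# covariant differences of site-framed functions, periodic covariant summation by parts, and the CURVATURE COMMUTATOR
# (supplier piece E-MLw-w4-W under row E-MLw-w4, file 1∕2; file 2∕2 = `NE3CovariantWeitzenbock`)

NE3 (node U1b) formalisation swarm, leaf seat `b2b-balaban-t4-ne3-formalise-leaf-03` (gen 6), supplier piece **E-MLw-w4-W**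
(INTENT `HOME/CLAIMS.log` 2026-08-20) under row E-MLw-w4 of `HOME/t4/formal/NE3/LEAVES.md` (owner skeleton v1.9 §4b, leaf
(ML_w) `NE3EnergyWeightedShapes.WeightedTangentCoercive`).  The tools of the covariant Weitzenböck inequality (file 2∕2):

* §1 the real Hilbert–Schmidt form `hsR X Y := Re tr(Xᴴ Y)∕n` (= `nReTr (Xᴴ * Y)`, the real part of `MatrixNorms.nhsInner`):
  symmetric, additive, `hsR X X = nhsNormSq X`, INVARIANT under `Ad_u` for unitary `u` (`hsR_Ad`, `hsR_Ad_left`),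
  `|hsR X Y| ≤ ‖X‖·‖Y‖` in operator norms, the parallelogram expansion `nhsNormSq (X − Y) = … − 2·hsR X Y`;
* §2 the covariant forward difference of a site-framed `𝔤`-valued function `cD V μ f x := Ad_{V(x,μ)} f(x+e_μ) − f(x)`
  ([Balaban1985BackgroundPropagators] (3.3) TYPE), its formal adjoint `cDstar V μ g x := Ad_{V(x−e_μ,μ)}⁻¹ g(x−e_μ) − g(x)`,
  the covariant divergence `cdiv V A x := Σ_μ (A_μ(x) − Ad_{V(x−e_μ,μ)}⁻¹ A_μ(x−e_μ)) = −Σ_μ cDstar V μ A_μ x`, periodicity,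
  and the PERIODIC COVARIANT SUMMATION BY PARTS **`sum_hsR_cD`**: `Σ_x hsR (cD V μ f x) (g x) = Σ_x hsR (f x) (cDstar V μ g x)`
  over one period box (unitary periodic `V`, periodic `f, g`; `Ad`-invariance + a periodic shift, no boundary term);
* §3 **THE COMMUTATOR**: `cDstar μ (cD ν h) (z+e_μ) − cD ν (cDstar μ h) (z+e_μ) = Ad_{V(z,μ)⁻¹}(W − Ad_{V(∂p)} W)` with
  `W = Ad_{V(z,ν)} h(z+e_ν)`, `p = (z; μ, ν)` (`cDstar_cD_sub_cD_cDstar`; `AveragingDeficitCovGrad.units_id₂`) — hence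
  **`norm_comm_le`**: operator norm `≤ 2a·‖h(z+e_ν)‖` when `‖V(∂p) − 1‖ ≤ a`.  At a flat configuration the commutator vanishes —
  the reason the flat identity of leaf (w2) (`NE3LatticeWeitzenbock`) is exact.

HONEST FRAMING.  [folklore] discrete covariant vector calculus at ONE unitary configuration — OUR proof frame (context only:
[Balaban1985BackgroundPropagators] §A (3.3), (3.8)); nothing about minimisers; NOT (ML_w), NOT T-E_w; NE3 NOT proved; spine
PROVED 0∕9; finite T⁴ rung (B)+1 — NOT infinite volume, NOT mass gap, NOT BetaPertH, NOT Clay.  PLACEMENT: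
`Summits/QuantumFields/BalabanUV/`; imports accepted modules only (`AveragingDeficitCovGrad` p218999, `NE3LatticeWeitzenbock` p219171).
-/
set_option autoImplicit false

open scoped BigOperators Matrix Matrix.Norms.L2Operator
open NormedSpace Finset

namespace Summit.QuantumFields.BalabanUV.T4Continuum.NE3CovariantCalculus

open Literature.MathematicalPhysics.QuantumFieldTheory.Balaban1983to89
open B7Prop1Explicit B7Prop2Explicit MatrixLog UnitaryModel MatrixNorms
open T4AveragingDeficitWall hiding Site Plane Plaq Bond
open T4AveragingDeficitWallBoundary (periodBox sum_periodBox_shift IsPeriodicCfg)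
open T4AveragingDeficitNonAbelian (Ad_mul Ad_sub)
open AveragingDeficitPeriodicCounting (IsPeriodicDir)
open AveragingDeficitTransport (norm_Ad_of_unitary mem_U1_of_unitary val_inv_eq_star_of_unitary)
open AveragingDeficitNearIdentity (Ad_one norm_Ad_sub_le nReTr_Ad Ad_mul_Ad abs_nReTr_mul_le)
open AveragingDeficitCovGrad (covFd covGradSq curlRem curlAt_eq_covFd_sub_add norm_curlRem_le hol_plaqWord_units units_id₂
  sum_plane_le_sum_pair)
open NE3HessShapes (plaqsOf sum_plaqsOf)
open NE3LatticeWeitzenbock (sum_sum_eq_two_mul_sum_plane)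
open MinimalActionWitness (flatCfg)

noncomputable section

variable {d : ℕ} {n : Type*} [Fintype n] [DecidableEq n]


/-! ## §1 The real Hilbert–Schmidt form -/

/-- THE REAL HILBERT–SCHMIDT FORM `hsR X Y = Re tr(Xᴴ Y)∕n` (the real part of `MatrixNorms.nhsInner`, written through
`UnitaryModel.nReTr`). [folklore] -/
def hsR (X Y : (Matrix n n ℂ)) : ℝ := nReTr (Xᴴ * Y)

omit [DecidableEq n] in
/-- `hsR X X = nhsNormSq X`. [folklore] -/
theorem hsR_self (X : (Matrix n n ℂ)) : hsR X X = nhsNormSq X := by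
  unfold hsR nReTr MatrixNorms.nhsNormSq
  rw [sum_norm_sq_eq_re_trace]

omit [DecidableEq n] in
/-- Symmetry. [folklore] -/
theorem hsR_comm (X Y : (Matrix n n ℂ)) : hsR X Y = hsR Y X := by
  unfold hsR
  rw [← nReTr_conjTranspose (Xᴴ * Y), Matrix.conjTranspose_mul, Matrix.conjTranspose_conjTranspose]

/-- Additivity on the left. [folklore] -/
theorem hsR_add_left (X X' Y : (Matrix n n ℂ)) : hsR (X + X') Y = hsR X Y + hsR X' Y := by
  unfold hsR
  rw [Matrix.conjTranspose_add, add_mul, T4TiltOscillation.nReTr_add]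

/-- Additivity on the right. [folklore] -/
theorem hsR_add_right (X Y Y' : (Matrix n n ℂ)) : hsR X (Y + Y') = hsR X Y + hsR X Y' := by
  rw [hsR_comm, hsR_add_left, hsR_comm Y, hsR_comm Y']

omit [DecidableEq n] in
/-- Subtraction on the left. [folklore] -/
theorem hsR_sub_left (X X' Y : (Matrix n n ℂ)) : hsR (X - X') Y = hsR X Y - hsR X' Y := by
  unfold hsR
  rw [Matrix.conjTranspose_sub, sub_mul, T4TiltOscillation.nReTr_sub]

omit [DecidableEq n] in
/-- Subtraction on the right. [folklore] -/
theorem hsR_sub_right (X Y Y' : (Matrix n n ℂ)) : hsR X (Y - Y') = hsR X Y - hsR X Y' := by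
  rw [hsR_comm, hsR_sub_left, hsR_comm Y, hsR_comm Y']

/-- Finite sums on the left. [folklore] -/
theorem hsR_sum_left {ι : Type*} (s : Finset ι) (f : ι → (Matrix n n ℂ)) (Y : (Matrix n n ℂ)) :
    hsR (∑ i ∈ s, f i) Y = ∑ i ∈ s, hsR (f i) Y := by
  classical
  induction s using Finset.induction_on with
  | empty => simp [hsR, nReTr]
  | insert i s hi ih => rw [Finset.sum_insert hi, Finset.sum_insert hi, hsR_add_left, ih]

/-- Finite sums on the right. [folklore] -/
theorem hsR_sum_right {ι : Type*} (s : Finset ι) (X : (Matrix n n ℂ)) (f : ι → (Matrix n n ℂ)) :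
    hsR X (∑ i ∈ s, f i) = ∑ i ∈ s, hsR X (f i) := by
  rw [hsR_comm, hsR_sum_left]
  exact Finset.sum_congr rfl fun i _ => hsR_comm _ _

/-- **`Ad`-INVARIANCE** for unitary `u`: `hsR (Ad_u X) (Ad_u Y) = hsR X Y`. [folklore] -/
theorem hsR_Ad {u : (Matrix n n ℂ)ˣ} (hu : u ∈ unitaryUnits (Matrix n n ℂ)) (X Y : (Matrix n n ℂ)) : hsR (Ad u X) (Ad u Y) = hsR X Y := by
  unfold hsR
  have h1 : (Ad u X)ᴴ = Ad u Xᴴ := by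
    unfold Ad
    rw [Matrix.conjTranspose_mul, Matrix.conjTranspose_mul, val_inv_eq_star_of_unitary hu,
      Matrix.star_eq_conjTranspose, Matrix.conjTranspose_conjTranspose, Matrix.mul_assoc]
  rw [h1, Ad_mul_Ad, nReTr_Ad]

/-- Moving `Ad_u` across the form: `hsR (Ad_u X) Y = hsR X (Ad_{u⁻¹} Y)` (unitary `u`). [folklore] -/
theorem hsR_Ad_left {u : (Matrix n n ℂ)ˣ} (hu : u ∈ unitaryUnits (Matrix n n ℂ)) (X Y : (Matrix n n ℂ)) : hsR (Ad u X) Y = hsR X (Ad u⁻¹ Y) := by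
  have hui : u⁻¹ ∈ unitaryUnits (Matrix n n ℂ) := (unitaryUnits (Matrix n n ℂ)).inv_mem hu
  have h := hsR_Ad hui (Ad u X) Y
  rw [← Ad_mul, inv_mul_cancel, Ad_one] at h
  exact h.symm

/-- **CAUCHY–SCHWARZ IN OPERATOR NORMS**: `|hsR X Y| ≤ ‖X‖·‖Y‖`. [folklore] -/
theorem abs_hsR_le (X Y : (Matrix n n ℂ)) : |hsR X Y| ≤ ‖X‖ * ‖Y‖ := by
  unfold hsR
  refine (abs_nReTr_mul_le _ _).trans ?_
  rw [Matrix.l2_opNorm_conjTranspose]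

omit [DecidableEq n] in
/-- The parallelogram-type expansion: `nhsNormSq (X − Y) = nhsNormSq X + nhsNormSq Y − 2·hsR X Y`. [folklore] -/
theorem nhsNormSq_sub (X Y : (Matrix n n ℂ)) : nhsNormSq (X - Y) = nhsNormSq X + nhsNormSq Y - 2 * hsR X Y := by
  rw [← hsR_self, hsR_sub_left, hsR_sub_right, hsR_sub_right, hsR_self, hsR_self, hsR_comm Y X]
  ring

/-- `nhsNormSq (X − Y) ≤ 2·(nhsNormSq X + nhsNormSq Y)`. [folklore] -/
theorem nhsNormSq_sub_le (X Y : (Matrix n n ℂ)) : nhsNormSq (X - Y) ≤ 2 * (nhsNormSq X + nhsNormSq Y) := by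
  have h1 := nhsNormSq_sub X Y
  have h2 : nhsNormSq (X + Y) = nhsNormSq X + nhsNormSq Y + 2 * hsR X Y := by
    rw [← hsR_self, hsR_add_left, hsR_add_right, hsR_add_right, hsR_self, hsR_self, hsR_comm Y X]; ring
  have h3 := nhsNormSq_nonneg (X + Y)
  linarith

omit [DecidableEq n] in
/-- `nhsNormSq (−X) = nhsNormSq X`. [folklore] -/
theorem nhsNormSq_neg (X : (Matrix n n ℂ)) : nhsNormSq (-X) = nhsNormSq X := by
  unfold MatrixNorms.nhsNormSq
  simp

/-! ## §2 Covariant differences of site-framed functions and the periodic summation by parts -/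

/-- THE COVARIANT FORWARD DIFFERENCE along `e_μ` of a site-framed `𝔤`-valued function (the value at `x + e_μ` transported
to the frame at `x` by `Ad_{V(x,μ)}`); [Balaban1985BackgroundPropagators] (3.3) TYPE. [folklore] -/
def cD (V : Site d → Fin d → (Matrix n n ℂ)ˣ) (μ : Fin d) (f : Site d → (Matrix n n ℂ)) (x : Site d) : (Matrix n n ℂ) :=
  Ad (V x μ) (f (x + e μ)) - f x

/-- ITS FORMAL ADJOINT for the form `hsR` summed over a period (§2 `sum_hsR_cD`): `Ad_{V(x−e_μ,μ)}⁻¹ g(x−e_μ) − g(x)`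
(minus the covariant BACKWARD difference). [folklore] -/
def cDstar (V : Site d → Fin d → (Matrix n n ℂ)ˣ) (μ : Fin d) (g : Site d → (Matrix n n ℂ)) (x : Site d) : (Matrix n n ℂ) :=
  Ad (V (x - e μ) μ)⁻¹ (g (x - e μ)) - g x

/-- THE COVARIANT DIVERGENCE of a site-framed 1-form: `Σ_μ (A_μ(x) − Ad_{V(x−e_μ,μ)}⁻¹ A_μ(x−e_μ)) = −Σ_μ cDstar V μ A_μ x`.
[folklore] -/
def cdiv (V : Site d → Fin d → (Matrix n n ℂ)ˣ) (A : Site d → Fin d → (Matrix n n ℂ)) (x : Site d) : (Matrix n n ℂ) :=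
  ∑ μ : Fin d, (A x μ - Ad (V (x - e μ) μ)⁻¹ (A (x - e μ) μ))

/-- `cdiv = −Σ_μ cDstar_μ A_μ`. [folklore] -/
theorem cdiv_eq_neg_sum_cDstar (V : Site d → Fin d → (Matrix n n ℂ)ˣ) (A : Site d → Fin d → (Matrix n n ℂ)) (x : Site d) :
    cdiv V A x = -∑ μ : Fin d, cDstar V μ (fun y => A y μ) x := by
  unfold cdiv cDstar
  rw [← Finset.sum_neg_distrib]
  exact Finset.sum_congr rfl fun μ _ => by abel

section Periodic

omit [Fintype n] [DecidableEq n] in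
/-- A `P`-periodic site function shifted by `−e_μ` then by a period. [folklore] -/
theorem periodic_sub {P : ℕ} {f : Site d → (Matrix n n ℂ)} (hf : ∀ (x : Site d) (κ : Fin d), f (x + (P : ℤ) • e κ) = f x)
    (x : Site d) (κ μ : Fin d) : f (x + (P : ℤ) • e κ - e μ) = f (x - e μ) := by
  rw [show x + (P : ℤ) • e κ - e μ = (x - e μ) + (P : ℤ) • e κ by abel, hf]

omit [Fintype n] [DecidableEq n] in
/-- A `P`-periodic site function shifted by `+e_μ` then by a period. [folklore] -/
theorem periodic_add {P : ℕ} {f : Site d → (Matrix n n ℂ)} (hf : ∀ (x : Site d) (κ : Fin d), f (x + (P : ℤ) • e κ) = f x)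
    (x : Site d) (κ μ : Fin d) : f (x + (P : ℤ) • e κ + e μ) = f (x + e μ) := by
  rw [show x + (P : ℤ) • e κ + e μ = (x + e μ) + (P : ℤ) • e κ by abel, hf]

/-- The covariant difference of a periodic function is periodic (periodic `V`). [folklore] -/
theorem cD_periodic {P : ℕ} {V : Site d → Fin d → (Matrix n n ℂ)ˣ} (hVP : IsPeriodicCfg V (P : ℤ)) (μ : Fin d) {f : Site d → (Matrix n n ℂ)}
    (hf : ∀ (x : Site d) (κ : Fin d), f (x + (P : ℤ) • e κ) = f x) (x : Site d) (κ : Fin d) :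
    cD V μ f (x + (P : ℤ) • e κ) = cD V μ f x := by
  unfold cD
  rw [hVP x κ μ, periodic_add hf, hf]

/-- The adjoint covariant difference of a periodic function is periodic (periodic `V`). [folklore] -/
theorem cDstar_periodic {P : ℕ} {V : Site d → Fin d → (Matrix n n ℂ)ˣ} (hVP : IsPeriodicCfg V (P : ℤ)) (μ : Fin d) {g : Site d → (Matrix n n ℂ)}
    (hg : ∀ (x : Site d) (κ : Fin d), g (x + (P : ℤ) • e κ) = g x) (x : Site d) (κ : Fin d) :
    cDstar V μ g (x + (P : ℤ) • e κ) = cDstar V μ g x := by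
  unfold cDstar
  have hV : V (x + (P : ℤ) • e κ - e μ) μ = V (x - e μ) μ := by
    rw [show x + (P : ℤ) • e κ - e μ = (x - e μ) + (P : ℤ) • e κ by abel, hVP]
  rw [hV, periodic_sub hg, hg]

/-- **PERIODIC COVARIANT SUMMATION BY PARTS**: for unitary `P`-periodic `V` (`P ≥ 1`) and `P`-periodic `f, g`,
`Σ_{x ∈ periodBox P} hsR (cD V μ f x) (g x) = Σ_{x ∈ periodBox P} hsR (f x) (cDstar V μ g x)` — `Ad`-invariance of `hsR`
and a periodic shift; no boundary term on the torus. [folklore] -/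
theorem sum_hsR_cD {P : ℕ} {V : Site d → Fin d → (Matrix n n ℂ)ˣ} (hP : 1 ≤ P) (hV : IsUnitaryCfg V) (hVP : IsPeriodicCfg V (P : ℤ)) (μ : Fin d)
    {f g : Site d → (Matrix n n ℂ)} (hf : ∀ (x : Site d) (κ : Fin d), f (x + (P : ℤ) • e κ) = f x)
    (hg : ∀ (x : Site d) (κ : Fin d), g (x + (P : ℤ) • e κ) = g x) :
    ∑ x ∈ periodBox (d := d) P, hsR (cD V μ f x) (g x) = ∑ x ∈ periodBox (d := d) P, hsR (f x) (cDstar V μ g x) := by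
  -- the transported term, shifted by one lattice step
  set G : Site d → ℝ := fun y => hsR (f y) (Ad (V (y - e μ) μ)⁻¹ (g (y - e μ))) with hG
  have hGper : ∀ (x : Site d) (κ : Fin d), G (x + (P : ℤ) • e κ) = G x := by
    intro x κ
    simp only [hG]
    rw [hf, show x + (P : ℤ) • e κ - e μ = (x - e μ) + (P : ℤ) • e κ by abel, hVP, hg]
  have hshift := sum_periodBox_shift (d := d) P hP hGper (e μ)
  have hterm : ∀ x : Site d, hsR (Ad (V x μ) (f (x + e μ))) (g x) = G (x + e μ) := by
    intro x
    simp only [hG, add_sub_cancel_right]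
    exact hsR_Ad_left (hV x μ) _ _
  calc ∑ x ∈ periodBox (d := d) P, hsR (cD V μ f x) (g x)
      = ∑ x ∈ periodBox (d := d) P, (hsR (Ad (V x μ) (f (x + e μ))) (g x) - hsR (f x) (g x)) :=
        Finset.sum_congr rfl fun x _ => by unfold cD; rw [hsR_sub_left]
    _ = ∑ x ∈ periodBox (d := d) P, G (x + e μ) - ∑ x ∈ periodBox (d := d) P, hsR (f x) (g x) := by
        rw [Finset.sum_sub_distrib]; exact congrArg₂ _ (Finset.sum_congr rfl fun x _ => hterm x) rfl
    _ = ∑ x ∈ periodBox (d := d) P, G x - ∑ x ∈ periodBox (d := d) P, hsR (f x) (g x) := by rw [hshift]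
    _ = ∑ x ∈ periodBox (d := d) P, hsR (f x) (cDstar V μ g x) := by
        rw [← Finset.sum_sub_distrib]
        exact Finset.sum_congr rfl fun x _ => by simp only [hG]; unfold cDstar; rw [hsR_sub_right]

end Periodic

/-! ## §3 The commutator of `cDstar_μ` and `cD_ν` is conjugation by the plaquette variable -/

/-- **THE COMMUTATOR IDENTITY** at the site `z + e_μ` (plaquette `p = (z; μ, ν)`):
`cDstar μ (cD ν h) (z+e_μ) − cD ν (cDstar μ h) (z+e_μ) = Ad_{V(z,μ)⁻¹} (W − Ad_{V(∂p)} W)`, `W = Ad_{V(z,ν)} h(z+e_ν)`. [folklore] -/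
theorem cDstar_cD_sub_cD_cDstar (V : Site d → Fin d → (Matrix n n ℂ)ˣ) (μ ν : Fin d) (h : Site d → (Matrix n n ℂ)) (z : Site d) :
    cDstar V μ (cD V ν h) (z + e μ) - cD V ν (cDstar V μ h) (z + e μ)
      = Ad (V z μ)⁻¹ (Ad (V z ν) (h (z + e ν)) - Ad (hol V z (plaqWord μ ν)) (Ad (V z ν) (h (z + e ν)))) := by
  have e1 : z + e μ - e μ = z := add_sub_cancel_right z (e μ)
  have e2 : z + e μ + e ν - e μ = z + e ν := by abel
  simp only [cDstar, cD]
  rw [e1, e2]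
  -- the two transports of `h (z + e ν)` to the frame at `z + e μ`
  have hT : Ad (V (z + e μ) ν) (Ad (V (z + e ν) μ)⁻¹ (h (z + e ν)))
      = Ad (V z μ)⁻¹ (Ad (hol V z (plaqWord μ ν)) (Ad (V z ν) (h (z + e ν)))) := by
    rw [← Ad_mul, ← Ad_mul, ← Ad_mul]
    congr 1
    rw [mul_assoc, ← units_id₂]
    group
  rw [Ad_sub, Ad_sub, hT, ← Ad_mul ((V z μ)⁻¹) (V z ν), Ad_mul, Ad_sub]
  abel

/-- **THE COMMUTATOR IS `O(a)`**: for unitary `V` with `‖V(∂p) − 1‖ ≤ a` at `p = (z; μ, ν)`,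
`‖cDstar μ (cD ν h) (z+e_μ) − cD ν (cDstar μ h) (z+e_μ)‖ ≤ 2a·‖h(z+e_ν)‖`. [folklore] -/
theorem norm_comm_le [Nonempty n] {V : Site d → Fin d → (Matrix n n ℂ)ˣ} (hV : IsUnitaryCfg V) (μ ν : Fin d) (h : Site d → (Matrix n n ℂ))
    (z : Site d) {a : ℝ} (hp : ‖((hol V z (plaqWord μ ν) : (Matrix n n ℂ)ˣ) : (Matrix n n ℂ)) - 1‖ ≤ a) :
    ‖cDstar V μ (cD V ν h) (z + e μ) - cD V ν (cDstar V μ h) (z + e μ)‖ ≤ 2 * a * ‖h (z + e ν)‖ := by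
  rw [cDstar_cD_sub_cD_cDstar, norm_Ad_of_unitary ((unitaryUnits (Matrix n n ℂ)).inv_mem (hV z μ)), ← norm_neg, neg_sub]
  have hP : hol V z (plaqWord μ ν) ∈ unitaryUnits (Matrix n n ℂ) := hol_mem_of hV _ _
  refine (norm_Ad_sub_le hP _).trans ?_
  rw [norm_Ad_of_unitary (hV z ν)]
  have h0 : 0 ≤ ‖h (z + e ν)‖ := norm_nonneg _
  nlinarith

end

end Summit.QuantumFields.BalabanUV.T4Continuum.NE3CovariantCalculus
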